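import Summits.CriticalPhenomena.SAWScalingLimit.Theorems.SAWMassiveIsingTiltLatticeUniversalityShiftedBdryEndpoints
import Summits.CriticalPhenomena.SAWScalingLimit.Theorems.SAWMassiveIsingTiltLatticeUniversalityFaceNesting
import Summits.CriticalPhenomena.SAWScalingLimit.Theorems.SAWDevelopingMapHexTransferGMHexDictionary
import Summits.CriticalPhenomena.SAWScalingLimit.Theorems.SAWMassiveIsingTiltHexEndpointApproxExists
import HarnessLib

/-!
# `AdmissibleTips`, bulk part (line `registered` = `birth` v4.3, crux `LatticeUniversality`,
# stmt-CriticalPhenomena-0807)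

Helper file of the stub `stub_admissibleTips` of the line `registered` for the crux
`Summit.CriticalPhenomena.SAWScalingLimit.Theses.SAWMassiveIsingTilt.LatticeUniversality`
(stmt-CriticalPhenomena-0807; main file `…AdmissibleTips`): the pieces of the bulk-attached
boundary mid-edge approximation of the face sets of the rotated, half-shifted domains
`S_δ(D) = σD − iδ/2` (`S_δ z = i z − iδ/2 = gmSimilarity δ`, `σ z = i z`) whose boundary-triangle
tips are an admissible hexagonal endpoint approximation of `D` itself.

* Positions (`S_δ⁻¹` is an isometry carrying `δ · rhombus g` onto the `ψ_δ`-image of the unit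
  square of `g`, which contains `δ · hexCenter v` for both triangles `v` of `g`;
  `exists_mem_rhombus_hexCenter_eq`): the mesh point of the tip `bdryVertex Δ e` is within `4δ` of
  `S_δ⁻¹ (δ · planeMidpoint e)` for EVERY face set `Δ` (`dist_hexCenter_bdryVertex_le`), whence tip
  convergence `δ · hexCenter (tip) → −i P` from `δ e_δ → P` (`tendsto_hexCenter_bdryVertex`); and
  the triangle `triWN` of the rhombus of a point `X` is within `4δ` of `S_δ⁻¹ (δ X)`
  (`dist_hexCenter_triWN_anchor_lt`, `symm_mul_anchor`).
* `reachable_bdryVertex_of_anchor` — tips whose rhombi are joined by chains of side-adjacent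
  rhombi of `(S_δ Ω)_δ` to an anchor rhombus `f₀` with `triWN f₀` in the discrete domain `Ω_δ`
  (largest honeycomb mesh component of `Ω = D.carrier`) are joined in the graph `Ω_δ`: the `π/3`
  dictionary joins them to `triWN f₀` in the honeycomb mesh graph of the face domain
  (`embMeshVertexGraph_reachable_of_walk`, `gmFace_bdryVertex`), a sub-domain of `Ω`
  (`faceDomain_shifted_subset_carrier`, `embMeshGraph_adj_mono`), and `Ω_δ` is closed under mesh
  adjacency (`reachable_embDomainGraph_of_walk`).
* `exists_bdry_threshold_anchor` — the stage threshold of p147051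
  (`ShiftedEndpoints.exists_bdry_threshold_translate`) redone with ONE more interior point `z₀`
  in the compact set `{z, w, z₀}` fed to the bulk lemma, so that the boundary rhombi found near the
  outside points are joined to the anchor rhombus of `(z₀ + t)/δ`.

Elementary; no definitions; tagged [folklore].
-/

noncomputable section

namespace Summit.CriticalPhenomena.SAWScalingLimit.Cruxes.LatticeUniversality.Birth

open MeasureTheory Filter Topology Set Metric
open scoped NNReal ENNReal BoundedContinuousFunction
open Complex (I I_ne_zero)
open Literature.Probability.RandomPlanarGeometry
open Literature.Probability.RandomPlanarGeometry.SAW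
open Literature.Probability.RandomPlanarGeometry.SAW.YangBaxter
open Literature.Probability.LatticeModels (Site HexVertex hexGraph hexCenter)
open Summit.CriticalPhenomena.SAWScalingLimit.Theses
open Summit.CriticalPhenomena.SAWScalingLimit.Cruxes.HexTransfer.YbRelay (third IsBdryEdge bdryVertex
  faceDomain gmSimilarity stub_gmHexDictionary)
open Summit.CriticalPhenomena.SAWScalingLimit.Cruxes.HexTransfer.YbRelay (triWN inclFace faceAdj
  faceComp gmFace gmSimilarity_symm_apply symm_image_rhombus psi sq sqPt mul_hexCenter_eq_psi
  sqPt_mem_openSq openSq_subset_sq gmFace_triWN gmFace_bdryVertex embMeshVertexGraph_reachable_of_walk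
  nonempty_ybWalk_of_reachable)
open Summit.CriticalPhenomena.SAWScalingLimit.Cruxes.HexTransfer.YbRelay.ThirdEndpoints
open Summit.CriticalPhenomena.SAWScalingLimit.Theorems.HexEndpointApprox
  (exists_forall_mem_hexMeshDomain_and_reachable reachable_embDomainGraph_of_walk)

namespace AdmissibleTips

/-! ### Positions: honeycomb vertices versus the rhombi of `H(π/3)` -/

/-- The inverse similarity `S_δ⁻¹ w = -i w + δ/2` is an isometry. [folklore] -/
theorem dist_gmSimilarity_symm (δ : ℝ) (u u' : ℂ) :
    dist ((gmSimilarity δ).symm u) ((gmSimilarity δ).symm u') = dist u u' := by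
  rw [gmSimilarity_symm_apply, gmSimilarity_symm_apply, dist_add_right, dist_eq_norm, dist_eq_norm,
    ← mul_sub, norm_mul, norm_neg, Complex.norm_I, one_mul]

/-- **The mesh point of a honeycomb vertex lies in the pulled-back rescaled rhombus carrying it**:
`δ · hexCenter v = S_δ⁻¹ (δ y)` for some `y` in the closed rhombus `gmFace v` of `H(π/3)`
(`δ · hexCenter v = ψ_δ (sqPt v)`, `sqPt v` in the unit square of `gmFace v`, and
`S_δ⁻¹ (δ · rhombus) = ψ_δ (square)`). [folklore] -/
theorem exists_mem_rhombus_hexCenter_eq (δ : ℝ) (v : HexVertex) :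
    ∃ y ∈ rhombus third (gmFace v), (δ : ℂ) * hexCenter v = (gmSimilarity δ).symm ((δ : ℂ) * y) := by
  have h : psi δ (sqPt v) ∈ psi δ '' sq (gmFace v) :=
    mem_image_of_mem _ (openSq_subset_sq _ (sqPt_mem_openSq v))
  rw [← symm_image_rhombus, Set.image_image] at h
  obtain ⟨y, hy, hyeq⟩ := h
  refine ⟨y, hy, ?_⟩
  rw [mul_hexCenter_eq_psi]
  exact hyeq.symm

/-- Every mid-edge is a side of `inclFace Δ e` (whichever of its two faces it is). [folklore] -/
theorem exists_side_inclFace (Δ : Set Face) (e : MidEdge) : ∃ s, (inclFace Δ e).side s = e := by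
  unfold inclFace
  split_ifs
  · exact (Face.exists_side_eq_iff _ e).2 (Or.inl rfl)
  · exact (Face.exists_side_eq_iff _ e).2 (Or.inr rfl)

/-- **Tip position.** For every face set `Δ`, mid-edge `e` and mesh `δ > 0`, the mesh point of the
boundary vertex `bdryVertex Δ e` (the triangle of `inclFace Δ e` resting on `e`) is within `4δ` of
`S_δ⁻¹ (δ · planeMidpoint e)`: both `δ · hexCenter` of the tip (pushed by `S_δ`) and `δ e` lie in
the rescaled closed rhombus of `inclFace Δ e`, of diameter `≤ 4δ`, and `S_δ⁻¹` is an isometry.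
[folklore] -/
theorem dist_hexCenter_bdryVertex_le (Δ : Set Face) (e : MidEdge) {δ : ℝ} (hδ : 0 < δ) :
    dist ((δ : ℂ) * hexCenter (bdryVertex Δ e))
      ((gmSimilarity δ).symm ((δ : ℂ) * planeMidpoint third e)) ≤ 4 * δ := by
  obtain ⟨y, hy, hyeq⟩ := exists_mem_rhombus_hexCenter_eq δ (bdryVertex Δ e)
  rw [gmFace_bdryVertex] at hy
  obtain ⟨s, hs⟩ := exists_side_inclFace Δ e
  have hm : planeMidpoint third e ∈ rhombus third (inclFace Δ e) := by
    have h := planeMidpoint_side_mem_rhombus third (inclFace Δ e) s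
    rwa [hs] at h
  have h1 := rhombus_const_subset_closedBall (Real.pi / 3) _ hy
  have h2 := rhombus_const_subset_closedBall (Real.pi / 3) _ hm
  rw [mem_closedBall] at h1 h2
  have h3 : dist y (planeMidpoint third e) ≤ 2 + 2 := (dist_triangle_right _ _ _).trans (add_le_add h1 h2)
  rw [hyeq, dist_gmSimilarity_symm, dist_eq_norm, ← mul_sub, norm_mul, Complex.norm_real,
    Real.norm_of_nonneg hδ.le, ← dist_eq_norm]
  nlinarith

/-- **Tip convergence.** If the rescaled midpoints `δ · a'_δ` converge to `P`, the mesh points of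
the tips `bdryVertex (Δ δ) a'_δ` converge to `-i P` (whatever the face sets `Δ δ`):
`S_δ⁻¹ (δ a'_δ) = -i δ a'_δ + δ/2 → -i P` and the tip is `4δ`-close to it. [folklore] -/
theorem tendsto_hexCenter_bdryVertex {Δ : ℝ → Set Face} {a' : ℝ → MidEdge} {P : ℂ}
    (h : Tendsto (fun δ : ℝ => (δ : ℂ) * planeMidpoint third (a' δ)) (𝓝[>] (0 : ℝ)) (𝓝 P)) :
    Tendsto (fun δ : ℝ => (δ : ℂ) * hexCenter (bdryVertex (Δ δ) (a' δ))) (𝓝[>] (0 : ℝ))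
      (𝓝 (-I * P)) := by
  have hδ0 : Tendsto (fun δ : ℝ => (δ : ℂ)) (𝓝[>] (0 : ℝ)) (𝓝 0) :=
    (Complex.continuous_ofReal.tendsto' 0 0 (by simp)).mono_left nhdsWithin_le_nhds
  have hg : Tendsto (fun δ : ℝ => (gmSimilarity δ).symm ((δ : ℂ) * planeMidpoint third (a' δ)))
      (𝓝[>] (0 : ℝ)) (𝓝 (-I * P)) := by
    have h' : Tendsto (fun δ : ℝ => -I * ((δ : ℂ) * planeMidpoint third (a' δ)) + (δ : ℂ) / 2)
        (𝓝[>] (0 : ℝ)) (𝓝 (-I * P + 0 / 2)) :=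
      (h.const_mul (-I)).add (hδ0.div_const 2)
    rw [zero_div, add_zero] at h'
    refine h'.congr fun δ => ?_
    rw [gmSimilarity_symm_apply]
  refine hg.congr_dist ?_
  have h4 : Tendsto (fun δ : ℝ => 4 * δ) (𝓝[>] (0 : ℝ)) (𝓝 0) := by
    have h'' : Tendsto (fun δ : ℝ => 4 * δ) (𝓝 (0 : ℝ)) (𝓝 (4 * 0)) :=
      (continuous_const.mul continuous_id).tendsto 0
    rw [mul_zero] at h''
    exact h''.mono_left nhdsWithin_le_nhds
  refine squeeze_zero' (Eventually.of_forall fun δ => dist_nonneg) ?_ h4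
  filter_upwards [self_mem_nhdsWithin] with δ hδ
  rw [dist_comm]
  exact dist_hexCenter_bdryVertex_le (Δ δ) (a' δ) hδ

/-- **Anchor position.** The mesh point of the triangle `triWN` of the rhombus of `H(π/3)`
containing the point `X` (skew coordinates rounded down, written exactly as in the bulk lemmas of
`…ThirdBdryEndpointsGeometry` at `θ = π/3`) is within `4δ` of `S_δ⁻¹ (δ X)` (corner of the rhombus
within `2` of `X`, rhombus of diameter `≤ 2` about its corner, `S_δ⁻¹` an isometry). [folklore] -/
theorem dist_hexCenter_triWN_anchor_lt {δ : ℝ} (hδ : 0 < δ) (X : ℂ) :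
    dist ((δ : ℂ) * hexCenter (triWN (⌊X.re / Real.sin (Real.pi / 3)⌋,
        ⌊X.im + X.re * Real.cos (Real.pi / 3) / Real.sin (Real.pi / 3) + 1 / 2⌋)))
      ((gmSimilarity δ).symm ((δ : ℂ) * X)) < 4 * δ := by
  have hs0 : Real.sin (Real.pi / 3) ≠ 0 := by rw [Real.sin_pi_div_three]; positivity
  obtain ⟨y, hy, hyeq⟩ := exists_mem_rhombus_hexCenter_eq δ (triWN (⌊X.re / Real.sin (Real.pi / 3)⌋,
    ⌊X.im + X.re * Real.cos (Real.pi / 3) / Real.sin (Real.pi / 3) + 1 / 2⌋))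
  rw [gmFace_triWN] at hy
  have h1 := rhombus_const_subset_closedBall (Real.pi / 3) _ hy
  rw [mem_closedBall] at h1
  have h2 := dist_planeCorner_face_lt hs0 X (θ := Real.pi / 3)
  have h3 : dist y X < 4 := by linarith [dist_triangle y (planeCorner third (⌊X.re / Real.sin (Real.pi / 3)⌋,
    ⌊X.im + X.re * Real.cos (Real.pi / 3) / Real.sin (Real.pi / 3) + 1 / 2⌋)) X]
  rw [hyeq, dist_gmSimilarity_symm, dist_eq_norm, ← mul_sub, norm_mul, Complex.norm_real,
    Real.norm_of_nonneg hδ.le, ← dist_eq_norm]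
  nlinarith

/-- `S_δ⁻¹` undoes the anchor's displacement: `S_δ⁻¹ (δ · ((i x₀ − iδ/2)/δ)) = x₀`. [folklore] -/
theorem symm_mul_anchor {δ : ℝ} (hδ : δ ≠ 0) (x₀ : ℂ) :
    (gmSimilarity δ).symm ((δ : ℂ) * ((I * x₀ + -(I * (δ : ℂ) / 2)) / δ)) = x₀ := by
  rw [mul_div_cancel₀ _ (Complex.ofReal_ne_zero.2 hδ), gmSimilarity_symm_apply]
  ring_nf
  rw [Complex.I_sq]
  ring

/-! ### Tips joined in the vertex discretisation of `D` through the anchor -/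

/-- **Tips attached to a bulk anchor are joined in `D_δ`.** In the face set `Δ = (S_δ Ω)_δ` of the
moving domain, let `a` be a boundary edge and let the rhombi `inclFace Δ a`, `inclFace Δ b` be
joined to a rhombus `f₀` by chains of side-adjacent rhombi of `Δ`, the triangle `triWN f₀` lying in
the discrete domain `Ω_δ` (largest honeycomb mesh component of `Ω = D.carrier`). Then the tips
`bdryVertex Δ a`, `bdryVertex Δ b` are joined in the graph `Ω_δ`: they are joined to `triWN f₀` in
the honeycomb mesh graph of the face domain at `a` (`embMeshVertexGraph_reachable_of_walk`), a
sub-domain of `Ω` (`faceDomain_shifted_subset_carrier`, `embMeshGraph_adj_mono`), and `Ω_δ` is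
closed under mesh adjacency (`reachable_embDomainGraph_of_walk`). [folklore] -/
theorem reachable_bdryVertex_of_anchor (D : DobrushinDomain) {δ : ℝ} (hδ : 0 < δ) {a b : MidEdge}
    {f₀ : Face}
    (ha : IsBdryEdge (meshFaces third (((D.map (similarity I I_ne_zero 0)).map
      (similarity 1 one_ne_zero (-(I * (δ : ℂ) / 2)))).carrier) δ) a)
    (hfa : (faceAdj (meshFaces third (((D.map (similarity I I_ne_zero 0)).map
      (similarity 1 one_ne_zero (-(I * (δ : ℂ) / 2)))).carrier) δ)).Reachable f₀
      (inclFace (meshFaces third (((D.map (similarity I I_ne_zero 0)).map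
        (similarity 1 one_ne_zero (-(I * (δ : ℂ) / 2)))).carrier) δ) a))
    (hfb : (faceAdj (meshFaces third (((D.map (similarity I I_ne_zero 0)).map
      (similarity 1 one_ne_zero (-(I * (δ : ℂ) / 2)))).carrier) δ)).Reachable f₀
      (inclFace (meshFaces third (((D.map (similarity I I_ne_zero 0)).map
        (similarity 1 one_ne_zero (-(I * (δ : ℂ) / 2)))).carrier) δ) b))
    (hu₀ : triWN f₀ ∈ embMeshDomain hexGraph hexCenter D.carrier δ) :
    (embDomainGraph hexGraph hexCenter D.carrier δ).Reachable
      (bdryVertex (meshFaces third (((D.map (similarity I I_ne_zero 0)).map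
        (similarity 1 one_ne_zero (-(I * (δ : ℂ) / 2)))).carrier) δ) a)
      (bdryVertex (meshFaces third (((D.map (similarity I I_ne_zero 0)).map
        (similarity 1 one_ne_zero (-(I * (δ : ℂ) / 2)))).carrier) δ) b) := by
  set Ω' := ((D.map (similarity I I_ne_zero 0)).map
    (similarity 1 one_ne_zero (-(I * (δ : ℂ) / 2)))).carrier with hΩ'
  have hδ0 : δ ≠ 0 := hδ.ne'
  have haC : inclFace (meshFaces third Ω' δ) a ∈ faceComp (meshFaces third Ω' δ) a :=
    ⟨ha.inclFace_spec.1, SimpleGraph.Reachable.refl _⟩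
  obtain ⟨pa⟩ := hfa.symm
  obtain ⟨pb⟩ := hfa.symm.trans hfb
  obtain ⟨_, _, hra⟩ := embMeshVertexGraph_reachable_of_walk Ω' hδ0 a pa haC
    (gmFace_bdryVertex (meshFaces third Ω' δ) a) (gmFace_triWN f₀)
  obtain ⟨_, _, hrb⟩ := embMeshVertexGraph_reachable_of_walk Ω' hδ0 a pb haC
    (gmFace_bdryVertex (meshFaces third Ω' δ) a) (gmFace_bdryVertex (meshFaces third Ω' δ) b)
  -- transport to the honeycomb mesh graph of `D`
  have hFD : faceDomain Ω' δ a ⊆ D.carrier := faceDomain_shifted_subset_carrier D δ a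
  let φ : embMeshVertexGraph hexGraph hexCenter (faceDomain Ω' δ a) δ →g
      embMeshVertexGraph hexGraph hexCenter D.carrier δ :=
    { toFun := fun v => ⟨v.1, hFD v.2⟩
      map_rel' := fun huv =>
        SimpleGraph.induce_adj.2 (embMeshGraph_adj_mono hFD (SimpleGraph.induce_adj.1 huv)) }
  have hra' := hra.map φ
  have hrb' := hrb.map φ
  obtain ⟨qa⟩ := hra'.symm
  obtain ⟨qb⟩ := hra'.symm.trans hrb'
  exact (reachable_embDomainGraph_of_walk qa hu₀).symm.trans (reachable_embDomainGraph_of_walk qb hu₀)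

/-! ### The stage threshold with a bulk anchor -/

/-- **Stage threshold in translated domains, with a bulk anchor.** Let `z, w, z₀ ∈ Ω` (a Dobrushin
domain `E`) and `p, q ∉ Ω`. There is `ε > 0` such that for every mesh `0 < δ < ε` and every
translate `t`, `‖t‖ ≤ δ`, there are boundary edges `a, b` of `(Ω + t)_δ = meshFaces (π/3) (Ω + t) δ`,
joined by a Yang–Baxter walk of `(Ω + t)_δ`, with `|δ a - p| ≤ 4 |z - p| + 5δ`,
`|δ b - q| ≤ 4 |w - q| + 5δ`, AND whose rhombi `inclFace _ a`, `inclFace _ b` are joined to the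
anchor rhombus of `(z₀ + t)/δ` by chains of side-adjacent rhombi of `(Ω + t)_δ` (the bulk set of
`Ω` about `z, w, z₀` translated by `t`; `exists_bdrySide_near` from the anchor rhombus at the
outside points `p + t`, `q + t`; `nonempty_ybWalk_of_reachable`; `IsBdryEdge.eq_inclFace`).
Stated as `∀ δ t, ∃ a b, 0 < δ → δ < ε → ‖t‖ ≤ δ → …`. [folklore] -/
theorem exists_bdry_threshold_anchor (E : DobrushinDomain) {z w z₀ : ℂ} (hz : z ∈ E.carrier)
    (hw : w ∈ E.carrier) (hz₀ : z₀ ∈ E.carrier) {p q : ℂ} (hp : p ∉ E.carrier)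
    (hq : q ∉ E.carrier) :
    ∃ ε : ℝ, 0 < ε ∧ ∀ (δ : ℝ) (t : ℂ), ∃ a b : MidEdge, 0 < δ → δ < ε → ‖t‖ ≤ δ →
      IsBdryEdge (meshFaces third ((E.map (similarity 1 one_ne_zero t)).carrier) δ) a ∧
      IsBdryEdge (meshFaces third ((E.map (similarity 1 one_ne_zero t)).carrier) δ) b ∧
      Nonempty (YangBaxterSAW third ((E.map (similarity 1 one_ne_zero t)).carrier) δ a b) ∧
      dist ((δ : ℂ) * planeMidpoint third a) p ≤ 4 * dist z p + 5 * δ ∧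
      dist ((δ : ℂ) * planeMidpoint third b) q ≤ 4 * dist w q + 5 * δ ∧
      (faceAdj (meshFaces third ((E.map (similarity 1 one_ne_zero t)).carrier) δ)).Reachable
        (⌊((z₀ + t) / δ).re / Real.sin (Real.pi / 3)⌋,
          ⌊((z₀ + t) / δ).im + ((z₀ + t) / δ).re * Real.cos (Real.pi / 3) / Real.sin (Real.pi / 3) + 1 / 2⌋)
        (inclFace (meshFaces third ((E.map (similarity 1 one_ne_zero t)).carrier) δ) a) ∧
      (faceAdj (meshFaces third ((E.map (similarity 1 one_ne_zero t)).carrier) δ)).Reachable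
        (⌊((z₀ + t) / δ).re / Real.sin (Real.pi / 3)⌋,
          ⌊((z₀ + t) / δ).im + ((z₀ + t) / δ).re * Real.cos (Real.pi / 3) / Real.sin (Real.pi / 3) + 1 / 2⌋)
        (inclFace (meshFaces third ((E.map (similarity 1 one_ne_zero t)).carrier) δ) b) := by
  have hθ : Real.pi / 3 ∈ Icc (Real.pi / 3) (2 * Real.pi / 3) := ⟨le_rfl, by linarith [Real.pi_pos]⟩
  have hs := half_lt_sin hθ
  have hc := abs_cos_le_half hθ
  have hs0 : Real.sin (Real.pi / 3) ≠ 0 := by positivity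
  have hK : ({z, w, z₀} : Set ℂ) ⊆ E.carrier := by
    intro x hx
    simp only [Set.mem_insert_iff, Set.mem_singleton_iff] at hx
    rcases hx with rfl | rfl | rfl
    exacts [hz, hw, hz₀]
  obtain ⟨V, -, hVc, hKV, -, ρ, hρ, hVρ⟩ :=
    Literature.Probability.LatticeModels.exists_isOpen_isPreconnected_bulk E.isOpen E.isConnected
      (Set.nonempty_compl.2 E.toJordanDomain.carrier_ne_univ) (Set.toFinite {z, w, z₀}).isCompact hK
  have hVΩ : ∀ x ∈ V, ball x ρ ⊆ E.carrier := fun x hx =>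
    (ball_subset_ball (hVρ x hx).le).trans ball_infDist_compl_subset
  have hzV : z ∈ V := hKV (by simp)
  have hwV : w ∈ V := hKV (by simp)
  have hz₀V : z₀ ∈ V := hKV (by simp)
  refine ⟨ρ / 5, by positivity, fun δ t => ?_⟩
  by_cases hgood : 0 < δ ∧ δ < ρ / 5 ∧ ‖t‖ ≤ δ
  swap
  · exact ⟨.vert 0 0, .vert 0 0, fun h₁ h₂ h₃ => absurd ⟨h₁, h₂, h₃⟩ hgood⟩
  obtain ⟨hδ, hδε, ht⟩ := hgood
  have hδρ : 5 * δ ≤ ρ := by linarith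
  -- the translated domain `Ω + t`
  have hmem : ∀ y : ℂ, y ∈ (E.map (similarity 1 one_ne_zero t)).carrier ↔ y - t ∈ E.carrier := by
    intro y
    simp only [MarkedDomain.carrier_map, Set.mem_image, similarity_apply, one_mul]
    constructor
    · rintro ⟨x, hx, rfl⟩
      rwa [add_sub_cancel_right]
    · exact fun h => ⟨y - t, h, sub_add_cancel y t⟩
  have hpt : p + t ∉ (E.map (similarity 1 one_ne_zero t)).carrier := fun h =>
    hp (by rwa [hmem, add_sub_cancel_right] at h)
  have hqt : q + t ∉ (E.map (similarity 1 one_ne_zero t)).carrier := fun h =>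
    hq (by rwa [hmem, add_sub_cancel_right] at h)
  -- the translated bulk set `V + t`
  have hVc' : IsPreconnected ((fun x : ℂ => x + t) '' V) :=
    hVc.image _ (continuous_add_const t).continuousOn
  have hVΩ' : ∀ x ∈ (fun x : ℂ => x + t) '' V,
      ball x ρ ⊆ (E.map (similarity 1 one_ne_zero t)).carrier := by
    rintro _ ⟨y, hy, rfl⟩ v hv
    rw [hmem]
    apply hVΩ y hy
    rw [mem_ball, dist_eq_norm] at hv ⊢
    rwa [show v - t - y = v - (y + t) by ring]
  have hzV' : z + t ∈ (fun x : ℂ => x + t) '' V := ⟨z, hzV, rfl⟩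
  have hwV' : w + t ∈ (fun x : ℂ => x + t) '' V := ⟨w, hwV, rfl⟩
  have hz₀V' : z₀ + t ∈ (fun x : ℂ => x + t) '' V := ⟨z₀, hz₀V, rfl⟩
  have hfin := meshFaces_const_finite hs hc (E.map (similarity 1 one_ne_zero t)).isBounded hδ
  have hfz := mem_meshFaces_const_of_dist_lt hδ hδρ (hVΩ' (z + t) hzV')
    ((dist_planeCorner_face_lt hs0 ((z + t) / δ)).trans (by norm_num))
  have hfw := mem_meshFaces_const_of_dist_lt hδ hδρ (hVΩ' (w + t) hwV')
    ((dist_planeCorner_face_lt hs0 ((w + t) / δ)).trans (by norm_num))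
  -- the faces of `z + t`, `w + t` are joined to the anchor rhombus of `z₀ + t`
  have hrz := reachable_const_of_mem hs hc hVc' hVΩ' hδ hδρ hz₀V' hzV'
  have hrw := reachable_const_of_mem hs hc hVc' hVΩ' hδ hδρ hz₀V' hwV'
  obtain ⟨ga, ea, hgaS, hga, hea, hua, hda⟩ := exists_bdrySide_near hs hc hδ hfin hpt hrz hfz
  obtain ⟨gb, eb, hgbS, hgb, heb, hub, hdb⟩ := exists_bdrySide_near hs hc hδ hfin hqt hrw hfw
  rw [dist_add_right] at hda hdb
  have hpt' : dist (p + t) p ≤ δ := by rwa [dist_eq_norm, add_sub_cancel_left]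
  have hqt' : dist (q + t) q ≤ δ := by rwa [dist_eq_norm, add_sub_cancel_left]
  have haI : IsBdryEdge (meshFaces third ((E.map (similarity 1 one_ne_zero t)).carrier) δ) ea :=
    isBdry_of_unique hea hgaS hua
  have hbI : IsBdryEdge (meshFaces third ((E.map (similarity 1 one_ne_zero t)).carrier) δ) eb :=
    isBdry_of_unique heb hgbS hub
  obtain ⟨sa, hsa⟩ := hea
  obtain ⟨sb, hsb⟩ := heb
  have hia : inclFace (meshFaces third ((E.map (similarity 1 one_ne_zero t)).carrier) δ) ea = ga :=
    (haI.eq_inclFace hsa hgaS).symm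
  have hib : inclFace (meshFaces third ((E.map (similarity 1 one_ne_zero t)).carrier) δ) eb = gb :=
    (hbI.eq_inclFace hsb hgbS).symm
  refine ⟨ea, eb, fun _ _ _ => ⟨haI, hbI, nonempty_ybWalk_of_reachable _ ga gb (hga.symm.trans hgb)
    hgaS ea eb ⟨sa, hsa⟩ hua ⟨sb, hsb⟩ hub, ?_, ?_, ?_, ?_⟩⟩
  · calc dist ((δ : ℂ) * planeMidpoint third ea) p
          ≤ dist ((δ : ℂ) * planeMidpoint third ea) (p + t) + dist (p + t) p := dist_triangle _ _ _
      _ ≤ 4 * dist z p + 4 * δ + δ := add_le_add hda hpt'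
      _ = 4 * dist z p + 5 * δ := by ring
  · calc dist ((δ : ℂ) * planeMidpoint third eb) q
          ≤ dist ((δ : ℂ) * planeMidpoint third eb) (q + t) + dist (q + t) q := dist_triangle _ _ _
      _ ≤ 4 * dist w q + 4 * δ + δ := add_le_add hdb hqt'
      _ = 4 * dist w q + 5 * δ := by ring
  · rw [hia]
    exact hga
  · rw [hib]
    exact hgb

/-- `‖-(iδ/2)‖ ≤ δ` for `δ > 0`: the half-period shift is an admissible translate. [folklore] -/
theorem norm_halfShift_le {δ : ℝ} (hδ : 0 < δ) : ‖(-(I * (δ : ℂ) / 2) : ℂ)‖ ≤ δ := by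
  simp only [norm_neg, norm_div, norm_mul, Complex.norm_I, one_mul, Complex.norm_real,
    Real.norm_eq_abs, abs_of_pos hδ, Complex.norm_ofNat]
  linarith

end AdmissibleTips

open AdmissibleTips in
/-- **Main statement of this file (bulk part of the stub `stub_admissibleTips`)**: in the face set
of the moving domain `S_δ(D)`, the tips of a boundary edge `a` and of a mid-edge `b` whose rhombi
`inclFace _ a`, `inclFace _ b` are joined to an anchor rhombus `f₀` by chains of side-adjacent
rhombi, with `triWN f₀` in the discrete domain `D_δ`, are joined in the graph `D_δ ⊆ δℍ`.
[folklore] -/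
theorem reachable_bdryVertex_shifted_of_anchor : ∀ (D : DobrushinDomain) (δ : ℝ), 0 < δ → ∀ (a b : MidEdge) (f₀ : Face), IsBdryEdge (meshFaces third (((D.map (similarity I I_ne_zero 0)).map (similarity 1 one_ne_zero (-(I * (δ : ℂ) / 2)))).carrier) δ) a → (faceAdj (meshFaces third (((D.map (similarity I I_ne_zero 0)).map (similarity 1 one_ne_zero (-(I * (δ : ℂ) / 2)))).carrier) δ)).Reachable f₀ (inclFace (meshFaces third (((D.map (similarity I I_ne_zero 0)).map (similarity 1 one_ne_zero (-(I * (δ : ℂ) / 2)))).carrier) δ) a) → (faceAdj (meshFaces third (((D.map (similarity I I_ne_zero 0)).map (similarity 1 one_ne_zero (-(I * (δ : ℂ) / 2)))).carrier) δ)).Reachable f₀ (inclFace (meshFaces third (((D.map (similarity I I_ne_zero 0)).map (similarity 1 one_ne_zero (-(I * (δ : ℂ) / 2)))).carrier) δ) b) → triWN f₀ ∈ embMeshDomain hexGraph hexCenter D.carrier δ → (embDomainGraph hexGraph hexCenter D.carrier δ).Reachable (bdryVertex (meshFaces third (((D.map (similarity I I_ne_zero 0)).map (similarity 1 one_ne_zero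 (-(I * (δ : ℂ) / 2)))).carrier) δ) a) (bdryVertex (meshFaces third (((D.map (similarity I I_ne_zero 0)).map (similarity 1 one_ne_zero (-(I * (δ : ℂ) / 2)))).carrier) δ) b) :=
  fun D _ hδ _ _ _ ha hfa hfb hu₀ => reachable_bdryVertex_of_anchor D hδ ha hfa hfb hu₀

end Summit.CriticalPhenomena.SAWScalingLimit.Cruxes.LatticeUniversality.Birth

end
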